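import Summits.HodgeConjecture.HodgeConjecture.Theorems.F0P3cStCharTSPrincipalSeriesUnitary   -- ★ `norm_apply_eq_one_of_apply_fixed_eq_one` («χ₁|_{F_v^×} = 1 ⇒ χ₁ unitary», `v` non-split)
import Summits.HodgeConjecture.HodgeConjecture.Theorems.R90S5OfCharUnitarizable               -- ★ (U-2) `isUnitarizable_mk_ofChar_of_norm_eq_one`
import Literature.NumberTheory.Automorphic.LocalUnitaryGroupUnimodularIsotropic              -- ★ `localPi_apply_eq_one_of_isotropic`, `antidiagOne_isotropic`
import Literature.NumberTheory.Automorphic.LocalNormOneHilbert90                             -- ★ local Hilbert 90 `exists_div_map_conjLocal_eq_of_mem_normOneUnits`; brings ★ `localDet`, ★ `glDiagonal_mem_unitaryGroupOfForm_antidiagonal_iff`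
import Literature.NumberTheory.Rogawski1990.LocalTransferUnmatchedLocus                      -- ★ `compactSpace_cmDatum_local_one_of_smul_eq` (`U(Φ₁)(L⁺_v)` compact at a non-split `v`)
import Literature.NumberTheory.Automorphic.GLnLeviWeightClassFunction                        -- ★ `isLocallyConstant_coe_of_isOpen_ker`
import Literature.NumberTheory.Automorphic.NormOneTorusAdelicCompact                         -- ★ `continuous_glDiagonal`
import Literature.NumberTheory.Automorphic.LocalUnitaryGroupCongr                            -- ★ `antidiagOne_isHermitian`, `isUnit_antidiagOne_det`, `map_cmConjRingHom_eq_map_complexConj`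
import HarnessLib

/-!
# R90-TF · S4 (Ch. 13.1–2) · brick (U-ns) — «SMOOTH CHARACTERS OF `H_v = U(Φ₂)(L⁺_v) × U(Φ₁)(L⁺_v)` ARE UNITARY AT A NON-SPLIT PLACE»:
# `‖ξ(h)‖ = 1` for every `ξ : H_v →* ℂˣ` with open kernel, hence `⟦ℂ_ξ⟧` is unitarizable (Rogawski 1990 §12.1 p. 171, §13.1 Thm. 13.1.1 (3) p. 198)

Cell `hodgecm-mathlib`, crux H413 (`stmt-HodgeConjecture-24833`, lane `--supports … --as helper`, count-neutral), route of record `HCCMUnconditional`;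
programme R90-TF (brief `director/R90-BRIEF.v2.md` 1f40d54518340a35), section S4 = Rogawski Ch. 13.1–2 (base `R90-C131`), RULING S4-R19 (3) brick **(U-ns)**
(S4 dealer K2E2-plan (g7), 2026-09-05T00:07:41Z), hand R90-C131-p04 (g2).  THEOREMS ONLY (no definition, no instance, no notation, no named fact, no
`sorry`); ★-only imports; axioms TRIO.

WHY (the consumer).  FILE A of S4 (`Cruxes/H413/Lines/R90_S4_LocalKitExportA.lean`) states the sub-socket LC-APKT `stub_R90_S4_lc_aPkt` :563, whose
clause (i) «the singleton `{⟦ℂ_ξ⟧}` is a CARRIER» unfolds (`IsCarrierH` :135) to `IsRogPacketH ∧ ¬ IsExceptionalH ∧ ∃ σ ∈ {⟦ℂ_ξ⟧}, σ.IsUnitarizable`.  The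
third conjunct is this file: at a NON-SPLIT `v` every smooth (= open-kernel) character `ξ` of `H_v` is unitary, so `⟦ℂ_ξ⟧` is unitarizable by ★ (U-2)
`isUnitarizable_mk_ofChar_of_norm_eq_one`.  (At a SPLIT `v`, `H_v ≅ GL₂(L_w) × L_w^×` has non-unitary characters, e.g. `|det|^s` — whence `hns`.)

THE MATHEMATICS ([Rogawski1990, §12.1 p. 171: `ρ = ρ₁ ⊗ χ`]; the factor `U(Φ₁)(L⁺_v) = E¹_v` is compact, and `U(Φ₂)(L⁺_v)^{ab}` is compact because
`SU(Φ₂)` is killed by every character and `det` lands in `E¹_v`):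
* §1 `norm_apply_eq_one_of_compactSpace` — a continuous character of a compact group is unitary (its norms form a bounded subgroup of `ℝ_{>0}`).
* §2 the factor `U(Φ₂)(L⁺_v)`:
  - `apply_eq_one_of_det_eq_one_U2Loc` (EVERY finite `v`): a homomorphism `U(Φ₂)(L⁺_v) →* A` to a commutative group kills the elements of determinant
    `1` — ★ `localPi_apply_eq_one_of_isotropic` (Dieudonné: `Φ₂` is isotropic through `e₀`, ★ `antidiagOne_isotropic`) read on the `cmDatum` carrier through
    ★ `localPiEquiv` (componentwise determinants, ★ `GLn.coe_piEquiv_apply`);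
  - `norm_apply_torusU2_eq_one` (`v` non-split): on the diagonal torus `d(a) = diag(a, (σa)⁻¹)` (★ `glDiagonal_mem_unitaryGroupOfForm_antidiagonal_iff`, as in
    ★ `localDet_two_surjective`) a continuous character `ξ₂` is unitary — `a ↦ ξ₂(d(a))` is a continuous character of `E_v^×` trivial on `F_v^×` (`σ a = a ⇒
    det d(a) = a/σa = 1`), hence unitary by ★ `norm_apply_eq_one_of_apply_fixed_eq_one` (`E¹_v` compact);
  - `norm_apply_U2Loc_eq_one` (`v` non-split): every `g` is `d(a)` times an element of determinant `1` — local Hilbert 90 ★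
    `exists_div_map_conjLocal_eq_of_mem_normOneUnits` writes `det g ∈ E¹_v` (★ `localDet`) as `a/σa`.
* §3 `norm_apply_HLoc_eq_one_of_isOpen_ker` — THE HEAD: for `ξ : H_v →* ℂˣ` with open kernel at a non-split `v`, `‖ξ(h)‖ = 1`
  (`h = (h₁, 1)·(1, h₂)`; §2 on the first factor, §1 + ★ `compactSpace_cmDatum_local_one_of_smul_eq` on the second; continuity from the open kernel, ★
  `isLocallyConstant_coe_of_isOpen_ker`).
* §4 `isUnitarizable_mk_ofChar_HLoc_nonsplit` — the A-frame corollary `(IrrClass.mk (SmoothIrrep.ofChar ξ hξ)).IsUnitarizable` (★ (U-2)).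

HONEST LABEL: count-neutral helper (lane `--supports`); it pays the third conjunct of clause (i) of ONE of the five open `_lc_*` laws of FILE A (the (APKT-i)
assembly also needs ★ p863330 `IsRogPacketH {⟦ℂ_ξ⟧}` and the (EXC-1D) brick); nothing here bears on the global clauses (ii) of LC-APKT or on LC-CARD ∕ SIGN ∕
OVERLAP ∕ UNRAM.  HC_CM is proved only modulo the 7 printed citations (2 remaining named inputs: hLiu418 = `stmt-HodgeConjecture-24832`, h413 =
`stmt-HodgeConjecture-24833`) until rung 0 closes.  REL ≠ ★ ≠ BUILT.

## References
* [Rogawski1990] J. D. Rogawski, *Automorphic Representations of Unitary Groups in Three Variables*, Ann. of Math. Stud. 123 (1990): §12.1 p. 171 (`Π(H)`,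
  `ρ = ρ₁ ⊗ χ`), §13.1 Thm. 13.1.1 (3) p. 198 and Prop. 13.1.4 p. 199 (the character packets `ρ = ξ`, `dim ξ = 1`), §1.9–§1.10 pp. 8–9 (the torus
  `d = diag(a, σ(a)⁻¹)`), §3.13 (the determinant on `U`).
* [Dieudonne1971GroupesClassiques] J. Dieudonné, *La géométrie des groupes classiques*, 3e éd. (1971), Chap. II §5 (characters of an isotropic unitary
  group factor through `det`).
* [CasselsFrohlichANT1967] J. W. S. Cassels, A. Fröhlich (eds.), *Algebraic Number Theory* (1967), Ch. VII §7.4 Cor. (a) (local Hilbert 90).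
* [PlatonovRapinchuk1994] V. Platonov, A. Rapinchuk, *Algebraic Groups and Number Theory* (1994), §3.1 Thm. 3.1, §6.2 (anisotropic tori are compact;
  characters of compact groups are unitary).
* [BushnellHenniart2006] C. J. Bushnell, G. Henniart, *The Local Langlands Conjecture for GL(2)* (2006), §1.5 (smooth = open kernel), §11.1.
-/

set_option autoImplicit false
-- the mandated namespace repeats the single-problem summit's segment (`HodgeConjecture.HodgeConjecture`)
set_option linter.dupNamespace false

noncomputable section

open NumberField IsDedekindDomain Matrix Topology
open Literature.NumberTheory.Automorphic Literature.NumberTheory.Automorphic.UnitaryGroup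
open Literature.NumberTheory.Rogawski1990
open Literature.LinearAlgebra.Matrix
open Summit.HodgeConjecture.HodgeConjecture.Cruxes.H413
open scoped MatrixGroups

namespace Summit.HodgeConjecture.HodgeConjecture.R90.S4

/-! ## §1 A continuous character of a compact group is unitary -/

/-- **A continuous character of a compact group is unitary**: for `K` compact and `χ : K →* ℂˣ` continuous, `‖χ(k)‖ = 1` — the norms of the values
form a bounded subgroup of `ℝ_{>0}` (if `‖χ k‖ > 1` its powers are unbounded), and `‖χ(k⁻¹)‖ = ‖χ(k)‖⁻¹`.  (The ten lines of ★
`F0P3cStCharTSPrincipalSeriesUnitary.norm_apply_normOneUnits_eq_one`, for an arbitrary compact `K`.) [cite: PlatonovRapinchuk1994, §6.2] -/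
theorem norm_apply_eq_one_of_compactSpace {K : Type*} [Group K] [TopologicalSpace K] [CompactSpace K]
    (χ : K →* ℂˣ) (hχ : Continuous fun k => ((χ k : ℂˣ) : ℂ)) (k : K) : ‖((χ k : ℂˣ) : ℂ)‖ = 1 := by
  have hc : Continuous fun k : K => ‖((χ k : ℂˣ) : ℂ)‖ := continuous_norm.comp hχ
  obtain ⟨M, hM⟩ := (isCompact_range hc).isBounded.bddAbove
  have hle : ∀ k : K, ‖((χ k : ℂˣ) : ℂ)‖ ≤ 1 := fun k => not_lt.mp fun hlt => by
    obtain ⟨m, hm⟩ := pow_unbounded_of_one_lt M hlt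
    have hm' : ‖((χ k : ℂˣ) : ℂ)‖ ^ m ≤ M := by
      have := hM (Set.mem_range_self (k ^ m))
      simpa only [map_pow, Units.val_pow_eq_pow_val, norm_pow] using this
    exact absurd hm' (not_le.mpr hm)
  refine le_antisymm (hle k) ?_
  have h1 := hle k⁻¹
  rw [map_inv, Units.val_inv_eq_inv_val, norm_inv] at h1
  exact (inv_le_one₀ (norm_pos_iff.mpr (Units.ne_zero _))).mp h1

/-! ## §2 The quasi-split factor `U(Φ₂)(L⁺_v)` -/

section U2

variable (L : Type) [Field L] [NumberField L] [IsCMField L] (v : HeightOneSpectrum (𝓞 ↥(maximalRealSubfield L)))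

/-- **Every homomorphism `U(Φ₂)(L⁺_v) →* A` to a commutative group kills the elements of determinant `1`** (EVERY finite `v`): ★
`localPi_apply_eq_one_of_isotropic` for the isotropic hermitian form `Φ₂` (★ `antidiagOne_isotropic`, ★ `antidiagOne_isHermitian`, ★ `isUnit_antidiagOne_det`),
read on the carrier `(cmDatum L 2 Φ₂).Local v` through ★ `localPiEquiv` — the components of the regrouped matrix have determinant `(det g)_w = 1`
(★ `GLn.coe_piEquiv_apply`). [cite: Dieudonne1971GroupesClassiques, Chap. II §5] [cite: Rogawski1990, §3.13] -/
theorem apply_eq_one_of_det_eq_one_U2Loc {A : Type*} [CommGroup A]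
    (θ : (cmDatum L 2 (Matrix.of fun i j : Fin 2 => if i.val + j.val + 1 = 2 then (1 : L) else 0)).Local v →* A)
    (g : (cmDatum L 2 (Matrix.of fun i j : Fin 2 => if i.val + j.val + 1 = 2 then (1 : L) else 0)).Local v)
    (hg : Matrix.GeneralLinearGroup.det (g.val : GL (Fin 2) (LocalRing L v)) = 1) : θ g = 1 := by
  have hgm : ((g.val : GL (Fin 2) (LocalRing L v)).val).det = 1 := by
    rw [← Matrix.GeneralLinearGroup.val_det_apply, hg, Units.val_one]
  have key := UnitaryGroup.localPi_apply_eq_one_of_isotropic L (Matrix.of fun i j : Fin 2 => if i.val + j.val + 1 = 2 then (1 : L) else 0)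
    ((map_cmConjRingHom_eq_map_complexConj L _) ▸ antidiagOne_isHermitian L 2) (isUnit_antidiagOne_det L 2).ne_zero
    (antidiagOne_isotropic L le_rfl) v
    (θ.comp (localPiEquiv L (IsCMField.complexConj L) 2 (Matrix.of fun i j : Fin 2 => if i.val + j.val + 1 = 2 then (1 : L) else 0) v).toMonoidHom)
    ((localPiEquiv L (IsCMField.complexConj L) 2 (Matrix.of fun i j : Fin 2 => if i.val + j.val + 1 = 2 then (1 : L) else 0) v).symm g)
    (fun w => by
      have hmat : (((((localPiEquiv L (IsCMField.complexConj L) 2 (Matrix.of fun i j : Fin 2 => if i.val + j.val + 1 = 2 then (1 : L) else 0) v).symm g :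
          localPi L (IsCMField.complexConj L) 2 (Matrix.of fun i j : Fin 2 => if i.val + j.val + 1 = 2 then (1 : L) else 0) v) : LocalGLPi L 2 v) w :
          GL (Fin 2) (w.1.adicCompletion L)).val) =
          ((g.val : GL (Fin 2) (LocalRing L v)).val).map (Pi.evalRingHom (fun w' : PlacesOver L v => w'.1.adicCompletion L) w) :=
        GLn.coe_piEquiv_apply _ _ _ _
      rw [hmat, ← RingHom.mapMatrix_apply, ← RingHom.map_det, hgm, map_one])
  have e : (localPiEquiv L (IsCMField.complexConj L) 2 (Matrix.of fun i j : Fin 2 => if i.val + j.val + 1 = 2 then (1 : L) else 0) v).toMonoidHom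
      ((localPiEquiv L (IsCMField.complexConj L) 2 (Matrix.of fun i j : Fin 2 => if i.val + j.val + 1 = 2 then (1 : L) else 0) v).symm g) = g :=
    (localPiEquiv L (IsCMField.complexConj L) 2 (Matrix.of fun i j : Fin 2 => if i.val + j.val + 1 = 2 then (1 : L) else 0) v).apply_symm_apply g
  exact (congrArg θ e).symm.trans key

variable (hns : ∀ w : PlacesOver L v, IsCMField.complexConj L • w.1 = w.1)

include hns in
/-- **A continuous character of `U(Φ₂)(L⁺_v)` is unitary on the diagonal torus** (`v` non-split): for a unit `a` of `E_v = L ⊗ L⁺_v` the matrix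
`d(a) = diag(a, (σa)⁻¹)` lies in `U(Φ₂)(L⁺_v)` (★ `glDiagonal_mem_unitaryGroupOfForm_antidiagonal_iff`) with `det d(a) = a/σa`; `a ↦ ξ₂(d(a))` is a continuous
character of `E_v^×` (★ `continuous_glDiagonal`) trivial on the `σ`-fixed units (`det = 1`, previous lemma), hence unitary (★ `norm_apply_eq_one_of_apply_fixed_eq_one`).
[cite: Rogawski1990, §1.9–§1.10 pp. 8–9; §12.1 p. 171] [cite: PlatonovRapinchuk1994, §6.2] -/
theorem norm_apply_torusU2_eq_one
    (ξ₂ : (cmDatum L 2 (Matrix.of fun i j : Fin 2 => if i.val + j.val + 1 = 2 then (1 : L) else 0)).Local v →* ℂˣ)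
    (hξ₂ : Continuous fun g => ((ξ₂ g : ℂˣ) : ℂ)) (a : (LocalRing L v)ˣ)
    (hmem : glDiagonal 2 (LocalRing L v)
        (fun i => if i = 0 then a else (Units.map (conjLocal L (IsCMField.complexConj L) v).toMonoidHom a)⁻¹) ∈
      «local» L (IsCMField.complexConj L) 2 (Matrix.of fun i j : Fin 2 => if i.val + j.val + 1 = 2 then (1 : L) else 0) v) :
    ‖((ξ₂ ⟨glDiagonal 2 (LocalRing L v)
        (fun i => if i = 0 then a else (Units.map (conjLocal L (IsCMField.complexConj L) v).toMonoidHom a)⁻¹), hmem⟩ : ℂˣ) : ℂ)‖ = 1 := by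
  -- abbreviations (terms only)
  let σ : LocalRing L v →+* LocalRing L v := conjLocal L (IsCMField.complexConj L) v
  let dv : (LocalRing L v)ˣ → Fin 2 → (LocalRing L v)ˣ := fun b i => if i = 0 then b else (Units.map σ.toMonoidHom b)⁻¹
  have hσσ : ∀ u : (LocalRing L v)ˣ, Units.map σ.toMonoidHom (Units.map σ.toMonoidHom u) = u := fun u =>
    Units.ext (conjLocal_conjLocal_cm L v (u : LocalRing L v))
  -- every `d(b)` lies in `U(Φ₂)(L⁺_v)`
  have hmemb : ∀ b : (LocalRing L v)ˣ, glDiagonal 2 (LocalRing L v) (dv b) ∈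
      «local» L (IsCMField.complexConj L) 2 (Matrix.of fun i j : Fin 2 => if i.val + j.val + 1 = 2 then (1 : L) else 0) v := by
    intro b
    show glDiagonal 2 (LocalRing L v) (dv b) ∈ unitaryGroupOfForm (conjLocal L (IsCMField.complexConj L) v) (cmLocalForm L 2 v)
    rw [cmLocalForm_eq_over, glDiagonal_mem_unitaryGroupOfForm_antidiagonal_iff]
    intro i
    fin_cases i
    · change σ ((dv b (Fin.rev 0) : (LocalRing L v)ˣ) : LocalRing L v) * (dv b 0 : LocalRing L v) = 1
      rw [show Fin.rev (0 : Fin 2) = 1 from rfl]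
      change σ (((Units.map σ.toMonoidHom b)⁻¹ : (LocalRing L v)ˣ) : LocalRing L v) * (b : LocalRing L v) = 1
      change ((Units.map σ.toMonoidHom ((Units.map σ.toMonoidHom b)⁻¹) : (LocalRing L v)ˣ) : LocalRing L v) * (b : LocalRing L v) = 1
      rw [map_inv, hσσ, ← Units.val_mul, inv_mul_cancel, Units.val_one]
    · change σ ((dv b (Fin.rev 1) : (LocalRing L v)ˣ) : LocalRing L v) * (dv b 1 : LocalRing L v) = 1
      rw [show Fin.rev (1 : Fin 2) = 0 from rfl]
      change ((Units.map σ.toMonoidHom b : (LocalRing L v)ˣ) : LocalRing L v) *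
        (((Units.map σ.toMonoidHom b)⁻¹ : (LocalRing L v)ˣ) : LocalRing L v) = 1
      rw [← Units.val_mul, mul_inv_cancel, Units.val_one]
  -- `d` as a homomorphism `E_v^× →* U(Φ₂)(L⁺_v)`
  have hdv_mul : ∀ b b' : (LocalRing L v)ˣ, dv (b * b') = dv b * dv b' := by
    intro b b'
    funext i
    by_cases hi : i = 0
    · simp only [dv, if_pos hi, Pi.mul_apply]
    · simp only [dv, if_neg hi, Pi.mul_apply, map_mul, mul_inv]
  let d : (LocalRing L v)ˣ →* (cmDatum L 2 (Matrix.of fun i j : Fin 2 => if i.val + j.val + 1 = 2 then (1 : L) else 0)).Local v :=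
    MonoidHom.mk' (fun b => ⟨glDiagonal 2 (LocalRing L v) (dv b), hmemb b⟩) fun b b' =>
      Subtype.ext (by
        change glDiagonal 2 (LocalRing L v) (dv (b * b')) = glDiagonal 2 (LocalRing L v) (dv b) * glDiagonal 2 (LocalRing L v) (dv b')
        rw [hdv_mul, map_mul])
  have hd_apply : ∀ b, d b = ⟨glDiagonal 2 (LocalRing L v) (dv b), hmemb b⟩ := fun _ => rfl
  -- continuity of `d`
  have hdv_cont : Continuous dv := by
    refine continuous_pi fun i => ?_
    by_cases hi : i = 0
    · simp only [dv, if_pos hi]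
      exact continuous_id
    · simp only [dv, if_neg hi]
      exact (Continuous.units_map σ.toMonoidHom (continuous_conjLocal L (IsCMField.complexConj L) v)).inv
  have hd_cont : Continuous d := by
    refine Continuous.subtype_mk ?_ _
    exact (continuous_glDiagonal (LocalRing L v)).comp hdv_cont
  -- the character `χ₁ := ξ₂ ∘ d` of `E_v^×` is continuous and trivial on the `σ`-fixed units
  let χ₁ : (LocalRing L v)ˣ →* ℂˣ := ξ₂.comp d
  have h1 : Continuous fun x => ((χ₁ x : ℂˣ) : ℂ) := hξ₂.comp hd_cont
  have htriv : ∀ b : (LocalRing L v)ˣ, conjLocal L (IsCMField.complexConj L) v (b : LocalRing L v) = b → χ₁ b = 1 := by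
    intro b hb
    have hσb : Units.map σ.toMonoidHom b = b := Units.ext hb
    change ξ₂ (d b) = 1
    refine apply_eq_one_of_det_eq_one_U2Loc L v ξ₂ (d b) (Units.ext ?_)
    rw [hd_apply]
    change (Units.val (glDiagonal 2 (LocalRing L v) (dv b))).det = ((1 : (LocalRing L v)ˣ) : LocalRing L v)
    rw [coe_glDiagonal, Matrix.det_diagonal, Fin.prod_univ_two]
    change (dv b 0 : LocalRing L v) * (dv b 1 : LocalRing L v) = _
    change (b : LocalRing L v) * (((Units.map σ.toMonoidHom b)⁻¹ : (LocalRing L v)ˣ) : LocalRing L v) = _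
    rw [hσb, ← Units.val_mul, mul_inv_cancel]
  have key := F0P3cStCharTSPrincipalSeriesUnitary.norm_apply_eq_one_of_apply_fixed_eq_one L v hns χ₁ h1 htriv a
  -- `χ₁ a = ξ₂ (d a)` and `d a` is the displayed torus element
  have hda : d a = ⟨glDiagonal 2 (LocalRing L v)
      (fun i => if i = 0 then a else (Units.map (conjLocal L (IsCMField.complexConj L) v).toMonoidHom a)⁻¹), hmem⟩ := Subtype.ext rfl
  have hχa : χ₁ a = ξ₂ (d a) := rfl
  rw [hχa, hda] at key
  exact key

include hns in
/-- **A continuous character of `U(Φ₂)(L⁺_v)` is unitary** (`v` non-split): `det g ∈ E¹_v` (★ `localDet`) is `a/σa` for a unit `a` (local Hilbert 90, ★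
`exists_div_map_conjLocal_eq_of_mem_normOneUnits`), so `g = d(a)·s` with `det s = 1`; `ξ₂(s) = 1` (Dieudonné) and `‖ξ₂(d(a))‖ = 1` (the torus lemma).
[cite: Rogawski1990, §12.1 p. 171; §3.13] [cite: CasselsFrohlichANT1967, Ch. VII §7.4 Cor. (a)] [cite: Dieudonne1971GroupesClassiques, Chap. II §5] -/
theorem norm_apply_U2Loc_eq_one
    (ξ₂ : (cmDatum L 2 (Matrix.of fun i j : Fin 2 => if i.val + j.val + 1 = 2 then (1 : L) else 0)).Local v →* ℂˣ)
    (hξ₂ : Continuous fun g => ((ξ₂ g : ℂˣ) : ℂ))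
    (g : (cmDatum L 2 (Matrix.of fun i j : Fin 2 => if i.val + j.val + 1 = 2 then (1 : L) else 0)).Local v) :
    ‖((ξ₂ g : ℂˣ) : ℂ)‖ = 1 := by
  let σ : LocalRing L v →+* LocalRing L v := conjLocal L (IsCMField.complexConj L) v
  have hσσ : ∀ u : (LocalRing L v)ˣ, Units.map σ.toMonoidHom (Units.map σ.toMonoidHom u) = u := fun u =>
    Units.ext (conjLocal_conjLocal_cm L v (u : LocalRing L v))
  -- `det g ∈ E¹_v`, and local Hilbert 90: `det g = a / σ a`
  let t := localDet (IsCMField.complexConj L) v (isUnit_antidiagOne_det L 2) g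
  obtain ⟨a, ha⟩ := exists_div_map_conjLocal_eq_of_mem_normOneUnits L (IsCMField.complexConj L)
    (Algebra.IsQuadraticExtension.finrank_eq_two _ L) (IsCMField.complexConj_ne_one (K := L)) t.2
  -- the torus element `d(a)`
  let dva : Fin 2 → (LocalRing L v)ˣ := fun i => if i = 0 then a else (Units.map σ.toMonoidHom a)⁻¹
  have hmem : glDiagonal 2 (LocalRing L v) dva ∈
      «local» L (IsCMField.complexConj L) 2 (Matrix.of fun i j : Fin 2 => if i.val + j.val + 1 = 2 then (1 : L) else 0) v := by
    show glDiagonal 2 (LocalRing L v) dva ∈ unitaryGroupOfForm (conjLocal L (IsCMField.complexConj L) v) (cmLocalForm L 2 v)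
    rw [cmLocalForm_eq_over, glDiagonal_mem_unitaryGroupOfForm_antidiagonal_iff]
    intro i
    fin_cases i
    · change σ ((dva (Fin.rev 0) : (LocalRing L v)ˣ) : LocalRing L v) * (dva 0 : LocalRing L v) = 1
      rw [show Fin.rev (0 : Fin 2) = 1 from rfl]
      change ((Units.map σ.toMonoidHom ((Units.map σ.toMonoidHom a)⁻¹) : (LocalRing L v)ˣ) : LocalRing L v) * (a : LocalRing L v) = 1
      rw [map_inv, hσσ, ← Units.val_mul, inv_mul_cancel, Units.val_one]
    · change σ ((dva (Fin.rev 1) : (LocalRing L v)ˣ) : LocalRing L v) * (dva 1 : LocalRing L v) = 1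
      rw [show Fin.rev (1 : Fin 2) = 0 from rfl]
      change ((Units.map σ.toMonoidHom a : (LocalRing L v)ˣ) : LocalRing L v) *
        (((Units.map σ.toMonoidHom a)⁻¹ : (LocalRing L v)ˣ) : LocalRing L v) = 1
      rw [← Units.val_mul, mul_inv_cancel, Units.val_one]
  let da : (cmDatum L 2 (Matrix.of fun i j : Fin 2 => if i.val + j.val + 1 = 2 then (1 : L) else 0)).Local v :=
    ⟨glDiagonal 2 (LocalRing L v) dva, hmem⟩
  -- `det d(a) = a / σ a = det g`
  have hdet_da : Matrix.GeneralLinearGroup.det (da.val : GL (Fin 2) (LocalRing L v)) = a / Units.map σ.toMonoidHom a := by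
    refine Units.ext ?_
    rw [Matrix.GeneralLinearGroup.val_det_apply]
    change (Units.val (glDiagonal 2 (LocalRing L v) dva)).det = _
    rw [coe_glDiagonal, Matrix.det_diagonal, Fin.prod_univ_two]
    change (a : LocalRing L v) * (((Units.map σ.toMonoidHom a)⁻¹ : (LocalRing L v)ˣ) : LocalRing L v) = _
    rw [← Units.val_mul, ← div_eq_mul_inv]
  have hdet_g : Matrix.GeneralLinearGroup.det (g.val : GL (Fin 2) (LocalRing L v)) = a / Units.map σ.toMonoidHom a := by
    rw [ha]
    exact (coe_localDet (IsCMField.complexConj L) v (isUnit_antidiagOne_det L 2) g).symm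
  -- `s := g · d(a)⁻¹` has determinant one, so `ξ₂ g = ξ₂ (d a)`
  have hs : Matrix.GeneralLinearGroup.det ((g * da⁻¹ :
      (cmDatum L 2 (Matrix.of fun i j : Fin 2 => if i.val + j.val + 1 = 2 then (1 : L) else 0)).Local v).val : GL (Fin 2) (LocalRing L v)) = 1 := by
    change Matrix.GeneralLinearGroup.det ((g.val : GL (Fin 2) (LocalRing L v)) * (da.val : GL (Fin 2) (LocalRing L v))⁻¹) = 1
    rw [map_mul, map_inv, hdet_g, hdet_da, mul_inv_cancel]
  have hgs : ξ₂ g = ξ₂ da := by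
    have h1 : ξ₂ (g * da⁻¹) = 1 := apply_eq_one_of_det_eq_one_U2Loc L v ξ₂ (g * da⁻¹) hs
    rwa [map_mul, map_inv, mul_inv_eq_one] at h1
  rw [hgs]
  exact norm_apply_torusU2_eq_one L v hns ξ₂ hξ₂ a hmem

end U2

/-! ## §3 THE HEAD: smooth characters of `H_v = U(Φ₂)(L⁺_v) × U(Φ₁)(L⁺_v)` are unitary at a non-split place -/

section H

variable (L : Type) [Field L] [NumberField L] [IsCMField L] (v : HeightOneSpectrum (𝓞 ↥(maximalRealSubfield L)))
  (hns : ∀ w : PlacesOver L v, IsCMField.complexConj L • w.1 = w.1)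

include hns in
/-- **(U-ns) SMOOTH CHARACTERS OF `H_v` ARE UNITARY AT A NON-SPLIT PLACE.**  Let `v` be a finite place of `L⁺` that does not split in `L` (`hns`) and
`ξ : H_v = U(Φ₂)(L⁺_v) × U(Φ₁)(L⁺_v) →* ℂˣ` a character with OPEN KERNEL (a smooth character).  Then `‖ξ(h)‖ = 1` for every `h`.  Proof: `ξ` is locally
constant hence continuous (★ `isLocallyConstant_coe_of_isOpen_ker`); `h = (h₁, 1)·(1, h₂)`; on the first factor §2 (`U(Φ₂)(L⁺_v)`: Dieudonné + Hilbert 90 +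
the compact torus `E¹_v`), on the second §1 — `U(Φ₁)(L⁺_v) = E¹_v` is compact at a non-split `v` (★ `compactSpace_cmDatum_local_one_of_smul_eq`).
[cite: Rogawski1990, §12.1 p. 171; §13.1 Thm. 13.1.1 (3) p. 198] [cite: PlatonovRapinchuk1994, §3.1 Thm. 3.1, §6.2] [cite: BushnellHenniart2006, §1.5] -/
theorem norm_apply_HLoc_eq_one_of_isOpen_ker
    (ξ : ((cmDatum L 2 (Matrix.of fun i j : Fin 2 => if i.val + j.val + 1 = 2 then (1 : L) else 0)).Local v ×
      (cmDatum L 1 (Matrix.of fun i j : Fin 1 => if i.val + j.val + 1 = 1 then (1 : L) else 0)).Local v) →* ℂˣ)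
    (hξ : IsOpen ((ξ.ker : Subgroup ((cmDatum L 2 (Matrix.of fun i j : Fin 2 => if i.val + j.val + 1 = 2 then (1 : L) else 0)).Local v ×
      (cmDatum L 1 (Matrix.of fun i j : Fin 1 => if i.val + j.val + 1 = 1 then (1 : L) else 0)).Local v)) :
        Set ((cmDatum L 2 (Matrix.of fun i j : Fin 2 => if i.val + j.val + 1 = 2 then (1 : L) else 0)).Local v ×
          (cmDatum L 1 (Matrix.of fun i j : Fin 1 => if i.val + j.val + 1 = 1 then (1 : L) else 0)).Local v)))
    (h : (cmDatum L 2 (Matrix.of fun i j : Fin 2 => if i.val + j.val + 1 = 2 then (1 : L) else 0)).Local v ×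
      (cmDatum L 1 (Matrix.of fun i j : Fin 1 => if i.val + j.val + 1 = 1 then (1 : L) else 0)).Local v) :
    ‖((ξ h : ℂˣ) : ℂ)‖ = 1 := by
  -- continuity of `ξ` from the open kernel
  have hξc : Continuous fun x => ((ξ x : ℂˣ) : ℂ) := (isLocallyConstant_coe_of_isOpen_ker ξ hξ).continuous
  -- the two partial characters
  let ξ₂ : (cmDatum L 2 (Matrix.of fun i j : Fin 2 => if i.val + j.val + 1 = 2 then (1 : L) else 0)).Local v →* ℂˣ :=
    ξ.comp (MonoidHom.inl _ _)
  let ξ₁ : (cmDatum L 1 (Matrix.of fun i j : Fin 1 => if i.val + j.val + 1 = 1 then (1 : L) else 0)).Local v →* ℂˣ :=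
    ξ.comp (MonoidHom.inr _ _)
  have hξ₂c : Continuous fun g => ((ξ₂ g : ℂˣ) : ℂ) := hξc.comp (continuous_id.prodMk continuous_const)
  have hξ₁c : Continuous fun u => ((ξ₁ u : ℂˣ) : ℂ) := hξc.comp (continuous_const.prodMk continuous_id)
  -- the factor `U(Φ₂)(L⁺_v)`: §2
  have h2 : ‖((ξ₂ h.1 : ℂˣ) : ℂ)‖ = 1 := norm_apply_U2Loc_eq_one L v hns ξ₂ hξ₂c h.1
  -- the factor `U(Φ₁)(L⁺_v) = E¹_v` is compact at a non-split `v`: §1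
  obtain ⟨w⟩ := (inferInstance : Nonempty (PlacesOver L v))
  haveI := compactSpace_cmDatum_local_one_of_smul_eq L v w (hns w)
  have h1 : ‖((ξ₁ h.2 : ℂˣ) : ℂ)‖ = 1 := norm_apply_eq_one_of_compactSpace ξ₁ hξ₁c h.2
  -- `h = (h₁, 1) · (1, h₂)`
  have hsplit : ξ h = ξ₂ h.1 * ξ₁ h.2 := by
    change ξ h = ξ (h.1, 1) * ξ (1, h.2)
    rw [← map_mul, Prod.fst_mul_snd]
  rw [hsplit, Units.val_mul, norm_mul, h2, h1, mul_one]

include hns in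
/-- **(U-ns), class form — `⟦ℂ_ξ⟧` IS UNITARIZABLE** for every smooth character `ξ` of `H_v` at a non-split `v`: the witness of the third conjunct
`∃ σ ∈ {⟦ℂ_ξ⟧}, σ.IsUnitarizable` of `IsCarrierH … {⟦ℂ_ξ⟧}` (FILE A :135, the LC-APKT clause (i) frame), by ★ (U-2) `isUnitarizable_mk_ofChar_of_norm_eq_one`
over the head. [cite: Rogawski1990, §13.1 Thm. 13.1.1 (3) p. 198, Prop. 13.1.4 p. 199; §12.1 p. 171] [cite: BushnellHenniart2006, §11.1] -/
theorem isUnitarizable_mk_ofChar_HLoc_nonsplit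
    (ξ : ((cmDatum L 2 (Matrix.of fun i j : Fin 2 => if i.val + j.val + 1 = 2 then (1 : L) else 0)).Local v ×
      (cmDatum L 1 (Matrix.of fun i j : Fin 1 => if i.val + j.val + 1 = 1 then (1 : L) else 0)).Local v) →* ℂˣ)
    (hξ : IsOpen ((ξ.ker : Subgroup ((cmDatum L 2 (Matrix.of fun i j : Fin 2 => if i.val + j.val + 1 = 2 then (1 : L) else 0)).Local v ×
      (cmDatum L 1 (Matrix.of fun i j : Fin 1 => if i.val + j.val + 1 = 1 then (1 : L) else 0)).Local v)) :
        Set ((cmDatum L 2 (Matrix.of fun i j : Fin 2 => if i.val + j.val + 1 = 2 then (1 : L) else 0)).Local v ×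
          (cmDatum L 1 (Matrix.of fun i j : Fin 1 => if i.val + j.val + 1 = 1 then (1 : L) else 0)).Local v))) :
    (IrrClass.mk (SmoothIrrep.ofChar ξ hξ)).IsUnitarizable :=
  R90.S5.isUnitarizable_mk_ofChar_of_norm_eq_one ξ hξ (norm_apply_HLoc_eq_one_of_isOpen_ker L v hns ξ hξ)

end H

end Summit.HodgeConjecture.HodgeConjecture.R90.S4

end
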